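import Literature.MathematicalPhysics.QuantumFieldTheory.Balaban1983to89.B9
import Literature.MathematicalPhysics.QuantumFieldTheory.Balaban1983to89.B9Thm311Data

/-!
# `Balaban1983to89.B9Thm311Whole` — [B9] Theorem 3.11 (p. 416) AS THE WHOLE PRINTED LEAF `B9.Thm311Printed` at a PINNED
# positivity reading `PosDefOfOps`: the five operators Δ′_a(U), G′(U), (Q′G′²Q′\*)⁻¹(U), Δ_a(U), G(U) as letters on real
# inner-product spaces, positive definiteness in the sense of `B9Thm311Data.PosDef`, and the printed proof glued

T. Bałaban, *Propagators for lattice gauge theories in a background field*, Commun. Math. Phys. **99** (1985) 389–434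
[`Balaban1985BackgroundPropagators`, "B9"]; [3] = T. Bałaban, *Propagators and renormalization transformations for lattice
gauge theories. I*, Commun. Math. Phys. **95** (1984) 17–40 [`Balaban1984PropagatorsI`].

statement-level skeleton of published theorems with citation tags; proofs where landed; nothing here is a claim about the
Yang–Mills mass gap

THE PRINTED LOCUS (verbatim, p. 416): *"Theorem 3.11. Under the assumptions of the Theorems 3.1–3.10 (i.e. for M sufficiently
large and α₀ sufficiently small) the operators Δ′_a, G′, (Q′G′²Q′\*)⁻¹, Δ_a, G are positive definite.  This is obvious for the
first three operators, and also for P and R, hence it is enough to prove it for G. It is a symmetric and invertible operator,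
so if it is not positive, then there exists A₀ ≠ 0, λ₀ > 0 such that GA₀ = −λ₀A₀. By (3.106) G = G₀(I − R)⁻¹, R is an operator
with small norm. Let us assume that the operator G₀ is positive, then […] This is in contradiction with the inequality
Re⟨A, (I − R\*)A⟩ = ⟨A, A⟩ − Re⟨A, RA⟩ ≧ (1 − O(M⁻¹))⟨A, A⟩ > 0 holding for M sufficiently large."*; (3.105) p. 414: *"Δ_aG₀ =
I − R"*; [3] p. 25: *"It is enough to prove that Q′_kG′_k²Q′\*_k is positive definite. This operator is of course nonnegative and
if for some ω … ⟨ω, Q′_kG′_k²Q′\*_kω⟩ = ‖G′_kQ′\*_kω‖² = 0, then Q′\*_kω = 0, hence ω = 0."*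

THE POINT.  The cell's typed skeleton `…Balaban1983to89.B9` carries Theorem 3.11 as ONE predicate `B9.Thm311Printed c35 geo bg
PosDef` = "∃ M₃ a₀ > 0, ∀ i, M₃ ≤ M → ∀ α₀ > 0, Mα₀ ≤ a₀ → ∀ U, (3.35) → ∀ n : Fin 5, PosDef i n U" over an ABSTRACT positivity
reading `PosDef : ∀ i, Fin 5 → (bg i).Cfg → Prop`; the N06 knit at the record consumes it only as the hypothesis `t311`.  The tree
holds the printed proof in pieces — the linear-algebra core (`B9.thm311_core`), the abstract step with and without the square
root (`B9Thm311.posDef_of_factor`, `…posDef_of_factor_rowSums`, real matrices), the «obvious» clause for Δ′_a, G′, (Q′G′²Q′\*)⁻¹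
(`B9Thm311Data`, real inner-product spaces), and the coercivity tower for the concrete lattice operators (`B9Thm311DeltaPrimeA`,
`B9Thm311SmallField*`, `B9Thm311SitePrimeForm*`, `B9Thm311LaplaceAk*`) — but no theorem concludes the leaf.  THIS FILE is that
glue, in the pattern of `B9Thm37Whole`:

* §1 `Ops311 B E F W` — the five operators and the auxiliary letters the printed proof reads (Q′(U), Q′\*(U), G₀(U) of (3.87), R(U)
  of (3.105)) at ONE member as functions of U, ℝ-linear on real inner-product spaces E ⊇ L²(Ω₀, 𝔤) (sites), F = L²(𝔅), W (bond
  fields) — a PARAMETER RECORD (a complex Hilbert space of the coercivity tower is read as a real one by restriction of scalars,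
  its `re ⟪x, Tx⟫_ℂ` positivity becoming `B9Thm311Data.PosDef`); `PosDefOfOps 𝔬 : Fin 5 → B.Cfg → Prop` — the reading PINNED:
  n ↦ `B9Thm311Data.PosDef` of Δ′_a(U), G′(U), (Q′G′²Q′\*)⁻¹(U), Δ_a(U), G(U) (REUSED, not re-declared).
* §2 the hypothesis schema `Inputs311 𝔬 θ₁ M U` (printed shape; nothing asserted): Δ′_a(U) positive definite and symmetric
  («obvious» — in the tree a THEOREM of the tower at the lattice letters, displayed here), G′ = (Δ′_a)⁻¹ ((3.25)), Q′\* the adjoint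
  of Q′ (p. 393) and injective ([3] p. 25), (Q′G′²Q′\*)·C = I, G₀(U) positive definite (*"Let us assume that the operator G₀ is
  positive"*), G(U) symmetric, (3.105)–(3.106) as G₀ = G(I − R), the smallness of R in the DISPLAYED L² form ⟨A, RA⟩ ≦ θ₁M⁻¹⟨A, A⟩
  (*"≧ (1 − O(M⁻¹))⟨A, A⟩"*; cell GAPS G-B9-06: print derives R's smallness in the sup form (3.85) — `B9Thm311.posDef_of_factor_rowSums`
  shows that suffices in the matrix model; here the displayed form is the hypothesis, as in `B9.thm311_core`), and G·Δ_a = I.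
* §3 the linear algebra of the printed proof: `posDef_of_rightInverse` (+ private `symm_of_rightInverse`, `injective_of_rightInverse`), `posDef_qggqs`
  ([3] p. 25's argument), `posDef_of_factor_small` — the printed eigenvector argument WITHOUT the square root on a finite-dimensional
  real inner-product space (the inner-product twin of `B9Thm311.posDef_of_factor`: an eigenvector v of the symmetric G with
  eigenvalue μ ≦ 0, B := (I − R)⁻¹v, gives 0 < ⟨B, G₀B⟩ = μ(⟨B, B⟩ − ⟨B, RB⟩) ≦ 0).
* §4 `posDefOfOps_all` (one member, one U, M ≧ 2θ₁: all five), ★ `thm311Printed_of_inputs` — **THE WHOLE PRINTED LEAF**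
  `B9.Thm311Printed c35 geo bg (fun i => PosDefOfOps (𝔬 i))` with M₃ := max(M₁, 2θ₁) («for M sufficiently large», located).

HONEST SCOPE.  Nothing of print is asserted: every clause of `Inputs311` is a hypothesis of printed shape (the positivity of
Δ′_a and of G₀, the inverse ∕ adjoint identities, the symmetry of G, the smallness of R); P and R (*"also for P and R"*) are not
among the five typed operators; the bond space W is taken finite-dimensional (the lattices are finite tori).  Value: kernel-checked
bookkeeping — the printed leaf inhabited over explicit letters by the printed argument — NOT a node discharge, NOT summit
progress; nothing continuum, nothing about the mass gap.  Cell `pub-ymgap` (HUMAN RULING D-0062), Track A node N06 [B9], seat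
`pub-ymgap-dag-n06-j` (N06-ASSIGNMENT v1 row 17), 2026-08-26.
-/

namespace Literature.MathematicalPhysics.QuantumFieldTheory.Balaban1983to89.B9Thm311Whole

open Literature.MathematicalPhysics.QuantumFieldTheory.Balaban1983to89

noncomputable section

/-! ## §1 The letters and the pinned positivity reading -/

section OneMember

variable {B : B9.Backgrounds} {E F W : Type*}
variable [NormedAddCommGroup E] [InnerProductSpace ℝ E] [NormedAddCommGroup F] [InnerProductSpace ℝ F]
  [NormedAddCommGroup W] [InnerProductSpace ℝ W]

/-- **THE LETTERS OF THEOREM 3.11 AT ONE FAMILY MEMBER**, as total functions of the background configuration U, ℝ-linear on real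
inner-product spaces E ⊇ L²(Ω₀, 𝔤) (site fields), F = L²(𝔅), W (bond fields): `DeltaPa U` = Δ′_a(U) ((3.24) p. 394), `Gp U` = G′(U) =
(Δ′_a)⁻¹ ((3.25)), `Qp U` = Q′(U), `Qps U` = Q′\*(U) ((3.18)–(3.19) p. 393), `Cinv U` = (Q′(U)G′²(U)Q′\*(U))⁻¹; `G0 U` = G₀ = Σ_□h_□G_□h_□
((3.87) p. 409), `R U` = R of (3.105) (Δ_aG₀ = I − R, p. 414), `GA U` = G(U) = G₀(I − R)⁻¹ ((3.106)), `DeltaA U` = Δ_a(U) ((3.26)).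
A PARAMETER RECORD — nothing is constructed or asserted (pattern of `B9Thm37Whole.Ops`).
[cite: Balaban1985BackgroundPropagators, Thm 3.11 p.416 + (3.24)–(3.26) pp.394–395 + (3.87) p.409 + (3.105)–(3.106) p.414] -/
structure Ops311 (B : B9.Backgrounds) (E F W : Type*) [NormedAddCommGroup E] [InnerProductSpace ℝ E]
    [NormedAddCommGroup F] [InnerProductSpace ℝ F] [NormedAddCommGroup W] [InnerProductSpace ℝ W] where
  DeltaPa : B.Cfg → E →ₗ[ℝ] E
  Gp : B.Cfg → E →ₗ[ℝ] E
  Qp : B.Cfg → E →ₗ[ℝ] F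
  Qps : B.Cfg → F →ₗ[ℝ] E
  Cinv : B.Cfg → F →ₗ[ℝ] F
  G0 : B.Cfg → W →ₗ[ℝ] W
  R : B.Cfg → W →ₗ[ℝ] W
  GA : B.Cfg → W →ₗ[ℝ] W
  DeltaA : B.Cfg → W →ₗ[ℝ] W

/-- ★ **THE POSITIVITY READING OF THEOREM 3.11, PINNED**: `PosDefOfOps 𝔬 n U` = «the n-th of the five operators Δ′_a(U), G′(U),
(Q′G′²Q′\*)⁻¹(U), Δ_a(U), G(U) is positive definite» in the sense fixed by the printed proof (*"if it is not positive, then there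
exists A₀ ≠ 0, λ₀ > 0 such that GA₀ = −λ₀A₀"*): `B9Thm311Data.PosDef T` = ∀ x ≠ 0, 0 < ⟨x, Tx⟩ (reused).
[cite: Balaban1985BackgroundPropagators, Thm 3.11 p.416] -/
def PosDefOfOps (𝔬 : Ops311 B E F W) : Fin 5 → B.Cfg → Prop
  | 0, U => B9Thm311Data.PosDef (𝔬.DeltaPa U)
  | 1, U => B9Thm311Data.PosDef (𝔬.Gp U)
  | 2, U => B9Thm311Data.PosDef (𝔬.Cinv U)
  | 3, U => B9Thm311Data.PosDef (𝔬.DeltaA U)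
  | 4, U => B9Thm311Data.PosDef (𝔬.GA U)

/-- Entry 0 of the reading is «Δ′_a(U) positive definite» (by `rfl`). [cite: Balaban1985BackgroundPropagators, Thm 3.11 p.416] -/
theorem posDefOfOps_zero (𝔬 : Ops311 B E F W) (U : B.Cfg) : PosDefOfOps 𝔬 0 U ↔ B9Thm311Data.PosDef (𝔬.DeltaPa U) := Iff.rfl

/-- Entry 1 of the reading is «G′(U) positive definite» (by `rfl`). [cite: Balaban1985BackgroundPropagators, Thm 3.11 p.416] -/
theorem posDefOfOps_one (𝔬 : Ops311 B E F W) (U : B.Cfg) : PosDefOfOps 𝔬 1 U ↔ B9Thm311Data.PosDef (𝔬.Gp U) := Iff.rfl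

/-- Entry 2 of the reading is «(Q′G′²Q′\*)⁻¹(U) positive definite» (by `rfl`). [cite: Balaban1985BackgroundPropagators, Thm 3.11 p.416] -/
theorem posDefOfOps_two (𝔬 : Ops311 B E F W) (U : B.Cfg) : PosDefOfOps 𝔬 2 U ↔ B9Thm311Data.PosDef (𝔬.Cinv U) := Iff.rfl

/-- Entry 3 of the reading is «Δ_a(U) positive definite» (by `rfl`). [cite: Balaban1985BackgroundPropagators, Thm 3.11 p.416] -/
theorem posDefOfOps_three (𝔬 : Ops311 B E F W) (U : B.Cfg) : PosDefOfOps 𝔬 3 U ↔ B9Thm311Data.PosDef (𝔬.DeltaA U) := Iff.rfl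

/-- Entry 4 of the reading is «G(U) positive definite» (by `rfl`). [cite: Balaban1985BackgroundPropagators, Thm 3.11 p.416] -/
theorem posDefOfOps_four (𝔬 : Ops311 B E F W) (U : B.Cfg) : PosDefOfOps 𝔬 4 U ↔ B9Thm311Data.PosDef (𝔬.GA U) := Iff.rfl

/-! ## §2 The hypothesis schema (printed shape; nothing asserted) -/

/-- **THE INPUTS OF THE PRINTED PROOF AT ONE MEMBER AND ONE CONFIGURATION U** (*"Under the assumptions of the Theorems 3.1–3.10"*),
each a hypothesis named where used, nothing asserted: `pos0` — Δ′_a(U) positive definite (*"This is obvious for the first three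
operators"*; p. 394: *"Assuming some regularity of the configuration U it can be easily shown that the operator Δ′_a is positive"* —
in the tree a theorem of the coercivity tower at the lattice letters, DISPLAYED here); `symm0` — Δ′_a symmetric (the quadratic form
(3.24)); `gp_right` — Δ′_aG′ = I ((3.25): *"G′ = G′(U) = (Δ′_a)⁻¹"*; in finite dimension a right inverse is two-sided); `adj` — Q′\* is the
adjoint of Q′ (scalar products of p. 393); `qps_inj` — Q′\* injective ([3] p. 25: *"then Q′\*_kω = 0, hence ω = 0"*); `c_right` —
(Q′G′²Q′\*)·C = I; `posG0` — *"Let us assume that the operator G₀ is positive"* (G₀ = Σ_□h_□G_□h_□, the G_□ positive by the induction);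
`symmG` — *"It is a symmetric … operator"*; `fac` — (3.105) Δ_aG₀ = I − R multiplied by G = Δ_a⁻¹: G₀ = G(I − R) (= (3.106) G = G₀(I − R)⁻¹);
`small` — *"R is an operator with small norm"* in the DISPLAYED form of the last inequality of the proof, ⟨A, RA⟩ ≦ θ₁M⁻¹⟨A, A⟩ with
its O(M⁻¹) named θ₁M⁻¹ (cell GAPS G-B9-06: the sup-form smallness (3.85) *"with O(M⁻¹) instead of O(α₁)"* (p. 414) is what print
derives; the L²-form is the located transfer — `B9Thm311.posDef_of_factor_rowSums` certifies the sup form suffices in the matrix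
model); `da_right` — GΔ_a = I (Δ_a = G⁻¹). [cite: Balaban1985BackgroundPropagators, Thm 3.11 proof p.416 + (3.24)–(3.25) p.394 + (3.105)–(3.106) p.414 + (3.85) p.407; Balaban1984PropagatorsI, p.25] -/
structure Inputs311 (𝔬 : Ops311 B E F W) (θ₁ M : ℝ) (U : B.Cfg) : Prop where
  pos0 : B9Thm311Data.PosDef (𝔬.DeltaPa U)
  symm0 : ∀ x y : E, inner ℝ (𝔬.DeltaPa U x) y = inner ℝ x (𝔬.DeltaPa U y)
  gp_right : ∀ x : E, 𝔬.DeltaPa U (𝔬.Gp U x) = x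
  adj : ∀ (x : E) (φ : F), inner ℝ (𝔬.Qp U x) φ = inner ℝ x (𝔬.Qps U φ)
  qps_inj : Function.Injective (𝔬.Qps U)
  c_right : ∀ φ : F, 𝔬.Qp U (𝔬.Gp U (𝔬.Gp U (𝔬.Qps U (𝔬.Cinv U φ)))) = φ
  posG0 : B9Thm311Data.PosDef (𝔬.G0 U)
  symmG : ∀ x y : W, inner ℝ (𝔬.GA U x) y = inner ℝ x (𝔬.GA U y)
  fac : 𝔬.G0 U = 𝔬.GA U ∘ₗ (1 - 𝔬.R U)
  small : ∀ A : W, inner ℝ A (𝔬.R U A) ≤ θ₁ * M⁻¹ * ‖A‖ ^ 2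
  da_right : ∀ x : W, 𝔬.GA U (𝔬.DeltaA U x) = x

end OneMember

/-! ## §3 The linear algebra of the printed proof ([folklore]) -/

section LinearAlgebra

variable {V V' : Type*} [NormedAddCommGroup V] [InnerProductSpace ℝ V] [NormedAddCommGroup V'] [InnerProductSpace ℝ V']

/-- A right inverse S of a positive definite T (T·S = I) is positive definite: ⟨y, Sy⟩ = ⟨TSy, Sy⟩ = ⟨Sy, T(Sy)⟩ > 0 for
y ≠ 0 (then Sy ≠ 0) — the printed *"obvious"* for G′ = (Δ′_a)⁻¹ and (Q′G′²Q′\*)⁻¹ (p. 416), and Δ_a = G⁻¹ once G > 0; elementary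
linear algebra. [cite: Balaban1985BackgroundPropagators, Thm 3.11 proof p.416] -/
theorem posDef_of_rightInverse {T S : V →ₗ[ℝ] V} (hT : B9Thm311Data.PosDef T) (hTS : ∀ y : V, T (S y) = y) : B9Thm311Data.PosDef S := by
  intro y hy
  have hx : S y ≠ 0 := by
    intro h0
    apply hy
    rw [← hTS y, h0, map_zero]
  have h := hT (S y) hx
  rwa [hTS y, real_inner_comm] at h

/-- A right inverse S of a symmetric T (T·S = I) is symmetric: ⟨Sx, y⟩ = ⟨Sx, T(Sy)⟩ = ⟨T(Sx), Sy⟩ = ⟨x, Sy⟩. [folklore] -/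
private theorem symm_of_rightInverse {T S : V →ₗ[ℝ] V} (hsymm : ∀ x y : V, inner ℝ (T x) y = inner ℝ x (T y))
    (hTS : ∀ y : V, T (S y) = y) (x y : V) : inner ℝ (S x) y = inner ℝ x (S y) := by
  conv_lhs => rw [← hTS y]
  conv_rhs => rw [← hTS x]
  rw [← hsymm]

/-- A right inverse S of T (T·S = I) is injective. [folklore] -/
private theorem injective_of_rightInverse {T S : V →ₗ[ℝ] V} (hTS : ∀ y : V, T (S y) = y) : Function.Injective S := by
  intro x y hxy
  rw [← hTS x, ← hTS y, hxy]

/-- **[3] p. 25's argument** (*"⟨ω, Q′_kG′_k²Q′\*_kω⟩ = ‖G′_kQ′\*_kω‖² = 0, then Q′\*_kω = 0, hence ω = 0"*): with Q′\* the adjoint of Q′, G′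
symmetric and injective and Q′\* injective, the operator Q′G′²Q′\* is positive definite. [cite: Balaban1984PropagatorsI, p.25] -/
theorem posDef_qggqs {q : V →ₗ[ℝ] V'} {qs : V' →ₗ[ℝ] V} {gp : V →ₗ[ℝ] V}
    (hadj : ∀ (x : V) (φ : V'), inner ℝ (q x) φ = inner ℝ x (qs φ))
    (hg : ∀ x y : V, inner ℝ (gp x) y = inner ℝ x (gp y)) (hginj : Function.Injective gp) (hqs : Function.Injective qs) :
    B9Thm311Data.PosDef (q ∘ₗ gp ∘ₗ gp ∘ₗ qs) := by
  intro ω hω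
  have hne : gp (qs ω) ≠ 0 := by
    intro h0
    apply hω
    apply hqs
    apply hginj
    rw [h0, map_zero, map_zero]
  have hsq : inner ℝ ω ((q ∘ₗ gp ∘ₗ gp ∘ₗ qs) ω) = inner ℝ (gp (qs ω)) (gp (qs ω)) := by
    simp only [LinearMap.comp_apply]
    rw [← real_inner_comm, hadj, hg]
  rw [hsq]
  exact real_inner_self_pos.mpr hne

/-- **THEOREM 3.11, THE ABSTRACT STEP FOR G (p. 416), WITHOUT THE SQUARE ROOT**, on a finite-dimensional real inner-product space —
the inner-product twin of the matrix lemma `B9Thm311.posDef_of_factor`.  `G` symmetric, `G₀` positive definite, `G₀ = G(I − R)`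
((3.105) multiplied by G = Δ_a⁻¹) and ⟨B, RB⟩ < ⟨B, B⟩ for B ≠ 0 (the printed *"(1 − O(M⁻¹))⟨A, A⟩ > 0"*) ⇒ `G` positive definite.
Proof: were ⟨x, Gx⟩ ≦ 0 for some x ≠ 0, an orthonormal eigenbasis of G (`LinearMap.IsSymmetric.eigenvectorBasis`) would carry an
eigenvalue μ ≦ 0 with eigenvector v (else ⟨x, Gx⟩ = Σ μᵢ⟨vᵢ, x⟩² > 0); I − R is injective by the smallness, hence onto, so v = (I − R)B
with B ≠ 0, and 0 < ⟨B, G₀B⟩ = ⟨B, Gv⟩ = μ⟨B, (I − R)B⟩ = μ(⟨B, B⟩ − ⟨B, RB⟩) ≦ 0 — the printed contradiction, run on an eigenvector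
instead of G₀^{1/2}. [cite: Balaban1985BackgroundPropagators, Thm 3.11 proof p.416] -/
theorem posDef_of_factor_small [FiniteDimensional ℝ V] (G G₀ R : V →ₗ[ℝ] V)
    (hG : ∀ x y : V, inner ℝ (G x) y = inner ℝ x (G y)) (hG₀ : B9Thm311Data.PosDef G₀) (hfac : G₀ = G ∘ₗ (1 - R))
    (hR : ∀ B : V, B ≠ 0 → inner ℝ B (R B) < inner ℝ B B) : B9Thm311Data.PosDef G := by
  classical
  have hGs : G.IsSymmetric := fun x y => hG x y
  -- I − R is injective, hence onto (finite dimension)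
  have hinj : Function.Injective (1 - R : V →ₗ[ℝ] V) := by
    intro B₁ B₂ h
    by_contra hne
    have hB : B₁ - B₂ ≠ 0 := sub_ne_zero.mpr hne
    have h0 : (1 - R) (B₁ - B₂) = 0 := by rw [map_sub, h, sub_self]
    have hRB : R (B₁ - B₂) = B₁ - B₂ := by
      rw [LinearMap.sub_apply, Module.End.one_apply, sub_eq_zero] at h0
      exact h0.symm
    have hlt := hR (B₁ - B₂) hB
    rw [hRB] at hlt
    exact lt_irrefl _ hlt
  have hsurj : Function.Surjective (1 - R : V →ₗ[ℝ] V) := LinearMap.injective_iff_surjective.mp hinj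
  intro x hx
  by_contra hle
  rw [not_lt] at hle
  -- an orthonormal eigenbasis of the symmetric G
  obtain ⟨n, hn⟩ : ∃ n : ℕ, Module.finrank ℝ V = n := ⟨_, rfl⟩
  set b := hGs.eigenvectorBasis hn with hbdef
  set ev := hGs.eigenvalues hn with hevdef
  have hGb : ∀ i, G (b i) = ev i • b i := fun i => by
    rw [hbdef, hevdef, hGs.apply_eigenvectorBasis hn i]
    rfl
  -- ⟨x, Gx⟩ = Σ μᵢ⟨vᵢ, x⟩²
  have hsum : inner ℝ x (G x) = ∑ i, ev i * inner ℝ (b i) x ^ 2 := by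
    rw [← b.sum_inner_mul_inner x (G x)]
    refine Finset.sum_congr rfl fun i _ => ?_
    rw [← hG (b i) x, hGb i, real_inner_smul_left, real_inner_comm (b i) x]
    ring
  -- some eigenvalue is ≤ 0
  have hex : ∃ i, ev i ≤ 0 := by
    by_contra hall
    push Not at hall
    obtain ⟨i, hi⟩ : ∃ i, inner ℝ (b i) x ≠ 0 := by
      by_contra hnone
      push Not at hnone
      apply hx
      have h := b.sum_inner_mul_inner x x
      rw [Finset.sum_eq_zero (fun i _ => by rw [hnone i, mul_zero])] at h
      exact inner_self_eq_zero.mp h.symm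
    have hpos : 0 < ∑ j, ev j * inner ℝ (b j) x ^ 2 :=
      Finset.sum_pos' (fun j _ => mul_nonneg (hall j).le (sq_nonneg _))
        ⟨i, Finset.mem_univ _, mul_pos (hall i) (by positivity)⟩
    rw [← hsum] at hpos
    exact absurd hpos (not_lt.mpr hle)
  obtain ⟨i, hi⟩ := hex
  -- the eigenvector vᵢ = (I − R)B with B ≠ 0
  obtain ⟨Bv, hBv⟩ := hsurj (b i)
  have hB0 : Bv ≠ 0 := by
    intro h0
    rw [h0, map_zero] at hBv
    exact b.orthonormal.ne_zero i hBv.symm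
  have h1 := hG₀ Bv hB0
  have h2 : inner ℝ Bv (G₀ Bv) = ev i * (inner ℝ Bv Bv - inner ℝ Bv (R Bv)) := by
    rw [hfac, LinearMap.comp_apply, hBv, hGb i, real_inner_smul_right, ← hBv, LinearMap.sub_apply, Module.End.one_apply,
      inner_sub_right]
  have h3 : 0 < inner ℝ Bv Bv - inner ℝ Bv (R Bv) := sub_pos.mpr (hR Bv hB0)
  rw [h2] at h1
  have h4 : ev i * (inner ℝ Bv Bv - inner ℝ Bv (R Bv)) ≤ 0 := mul_nonpos_of_nonpos_of_nonneg hi h3.le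
  exact absurd h1 (not_lt.mpr h4)

/-- Arithmetic of «for M sufficiently large»: ⟨A, RA⟩ ≦ θ₁M⁻¹‖A‖² with M ≧ 2θ₁, M > 0 gives ⟨A, RA⟩ < ⟨A, A⟩ for A ≠ 0
(θ₁M⁻¹ ≦ ½). [folklore] -/
private theorem inner_lt_of_small {R : V →ₗ[ℝ] V} {θ₁ M : ℝ} (hM : 0 < M) (hMbig : 2 * θ₁ ≤ M)
    (hsmall : ∀ A : V, inner ℝ A (R A) ≤ θ₁ * M⁻¹ * ‖A‖ ^ 2) (A : V) (hA : A ≠ 0) :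
    inner ℝ A (R A) < inner ℝ A A := by
  have hn : 0 < ‖A‖ ^ 2 := by positivity
  have hq : θ₁ * M⁻¹ ≤ 1 / 2 := by
    rw [← div_eq_mul_inv, div_le_iff₀ hM]
    linarith
  calc inner ℝ A (R A) ≤ θ₁ * M⁻¹ * ‖A‖ ^ 2 := hsmall A
    _ ≤ 1 / 2 * ‖A‖ ^ 2 := mul_le_mul_of_nonneg_right hq hn.le
    _ < ‖A‖ ^ 2 := by linarith
    _ = inner ℝ A A := (real_inner_self_eq_norm_sq A).symm

end LinearAlgebra

/-! ## §4 Theorem 3.11 at one member and one U; the whole printed leaf -/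

section Whole

variable {B : B9.Backgrounds} {E F W : Type*}
variable [NormedAddCommGroup E] [InnerProductSpace ℝ E] [NormedAddCommGroup F] [InnerProductSpace ℝ F]
  [NormedAddCommGroup W] [InnerProductSpace ℝ W]

/-- **THEOREM 3.11 AT ONE MEMBER AND ONE CONFIGURATION — ALL FIVE OPERATORS**, from the inputs of printed shape (`Inputs311`) under
«M sufficiently large» LOCATED as M ≧ 2θ₁ (M > 0): Δ′_a > 0 (displayed), G′ > 0 and symmetric as its inverse, Q′G′²Q′\* > 0 by [3]
p. 25 hence (Q′G′²Q′\*)⁻¹ > 0 (*"obvious for the first three operators"*), G > 0 by `posDef_of_factor_small` (G₀ > 0, G symmetric,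
G₀ = G(I − R), ⟨A, RA⟩ ≦ θ₁M⁻¹‖A‖² < ‖A‖²), Δ_a > 0 as G⁻¹.  Bond space finite-dimensional. [cite: Balaban1985BackgroundPropagators, Thm 3.11 p.416 + (3.105)–(3.106) p.414; Balaban1984PropagatorsI, p.25] -/
theorem posDefOfOps_all [FiniteDimensional ℝ W] (𝔬 : Ops311 B E F W) {θ₁ M : ℝ} {U : B.Cfg} (hM : 0 < M)
    (hMbig : 2 * θ₁ ≤ M) (h : Inputs311 𝔬 θ₁ M U) (n : Fin 5) : PosDefOfOps 𝔬 n U := by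
  have h1 : B9Thm311Data.PosDef (𝔬.Gp U) := posDef_of_rightInverse h.pos0 h.gp_right
  have h4 : B9Thm311Data.PosDef (𝔬.GA U) :=
    posDef_of_factor_small (𝔬.GA U) (𝔬.G0 U) (𝔬.R U) h.symmG h.posG0 h.fac (inner_lt_of_small hM hMbig h.small)
  match n with
  | 0 => exact h.pos0
  | 1 => exact h1
  | 2 =>
      have hL : B9Thm311Data.PosDef (𝔬.Qp U ∘ₗ 𝔬.Gp U ∘ₗ 𝔬.Gp U ∘ₗ 𝔬.Qps U) :=
        posDef_qggqs h.adj (symm_of_rightInverse h.symm0 h.gp_right) (injective_of_rightInverse h.gp_right) h.qps_inj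
      exact posDef_of_rightInverse hL (fun φ => by simpa only [LinearMap.comp_apply] using h.c_right φ)
  | 3 => exact posDef_of_rightInverse h4 h.da_right
  | 4 => exact h4

end Whole

section Family

variable {I : Type} {c35 : ℝ} {geo : I → B9.Geometry} {bg : I → B9.Backgrounds}
variable {E F W : I → Type*}
variable [∀ i, NormedAddCommGroup (E i)] [∀ i, InnerProductSpace ℝ (E i)] [∀ i, NormedAddCommGroup (F i)]
  [∀ i, InnerProductSpace ℝ (F i)] [∀ i, NormedAddCommGroup (W i)] [∀ i, InnerProductSpace ℝ (W i)]
  [∀ i, FiniteDimensional ℝ (W i)]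

/-- ★ **THEOREM 3.11 AS THE WHOLE PRINTED LEAF `B9.Thm311Printed`** (p. 416: *"Under the assumptions of the Theorems 3.1–3.10 (i.e.
for M sufficiently large and α₀ sufficiently small) the operators Δ′_a, G′, (Q′G′²Q′\*)⁻¹, Δ_a, G are positive definite."*), INHABITED
at the pinned reading `PosDefOfOps (𝔬 i)` — from, per member and per U under the provisos of Theorems 3.1–3.10 (M ≧ M₁, 0 < α₀,
Mα₀ ≦ a₁, U satisfying (3.35) = `Reg335 c35 α₀ U`), the inputs of the printed proof `Inputs311 (𝔬 i) θ₁ (geo i).M U`.  The printed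
quantifiers are met with M₃ := max(M₁, 2θ₁) («for M sufficiently large», located) and a₀ := a₁.  Nothing of print asserted (all
inputs are hypotheses of printed shape); NOT a node discharge. [cite: Balaban1985BackgroundPropagators, Thm 3.11 p.416 + (3.35) p.396] -/
theorem thm311Printed_of_inputs (𝔬 : ∀ i, Ops311 (bg i) (E i) (F i) (W i)) (θ₁ a₁ M₁ : ℝ) (ha₁ : 0 < a₁)
    (hM₁ : 0 < M₁)
    (h : ∀ i, M₁ ≤ (geo i).M → ∀ α₀ : ℝ, 0 < α₀ → (geo i).M * α₀ ≤ a₁ →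
      ∀ U : (bg i).Cfg, (bg i).Reg335 c35 α₀ U → Inputs311 (𝔬 i) θ₁ (geo i).M U) :
    B9.Thm311Printed c35 geo bg (fun i => PosDefOfOps (𝔬 i)) := by
  refine ⟨max M₁ (2 * θ₁), a₁, lt_max_of_lt_left hM₁, ha₁, fun i hM α₀ hα₀ hMa U hU n => ?_⟩
  have hM₁i : M₁ ≤ (geo i).M := le_trans (le_max_left _ _) hM
  have hMpos : 0 < (geo i).M := lt_of_lt_of_le hM₁ hM₁i
  exact posDefOfOps_all (𝔬 i) hMpos (le_trans (le_max_right _ _) hM) (h i hM₁i α₀ hα₀ hMa U hU) n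

end Family

end

end Literature.MathematicalPhysics.QuantumFieldTheory.Balaban1983to89.B9Thm311Whole
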